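import Summits.CriticalPhenomena.PercolationContinuityZ3.Theorems.PercNearOneGluingNoHeavyLowerTailSahiThreeCopyPairHalfAnd
import Summits.CriticalPhenomena.PercolationContinuityZ3.Theorems.PercNearOneGluingNoHeavyLowerTailSahiThreeCopyPairOrLiterals
import Summits.CriticalPhenomena.PercolationContinuityZ3.Theorems.PercNearOneGluingNoHeavyLowerTailSahiThreeCopyMixedLiterals

/-!
# `NoHeavyLowerTail` (crux stmt-CriticalPhenomena-4575), Sahi programme: **THE HALF-LITERAL OR STEP** — `UG(f, G⁰) ⇒ UG(f ∨ x₀, G)` for an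
# ARBITRARY monotone `G` on the bigger cube — and the corollary: **EVERY TOP-LEVEL LITERAL OF EITHER MEMBER PEELS OFF**

Support file (Sahi cell, seat `prim-sahi-p1`, generation 56; `--supports stmt-CriticalPhenomena-4575`); companion of `…PairHalfAnd`.
COMPUTATIONAL only through the import of `…PairsClosure` (base `≤ 4`, used in §3); §1–§2 use standard axioms.  Vocabulary: `orAdj` /
`andAdj` (`…Literals`), `litAdj` / `litAdjoin` / `Kind` (`…MixedLiterals`), `UGood` (`…Pairs`).

The fresh coordinate `x₀` enters the first member as an OR-literal (`f ∨ x₀`, `f ≤ 1`) and the second member `G` ARBITRARILY (sections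
`G⁰ ≤ G¹`, `δ = G¹ − G⁰`); the third function `H` is free (`η = H¹ − H⁰`).  With `f̄ = 1 − f` and `N = N_{b'}`, the profile entries of
`c_{(k,b')}(f ∨ x₀, G, H)` are EXACTLY (identities for all real data; formal three-copy algebra, memo FROM-prim-sahi-p1-gen56; the LP of kit
job j334676 found the `k = 1` certificate, then simplified by hand):
* `k = 0`: `c(f, G⁰, H⁰)`;   `k = 3`: `N(G¹H¹;1;1) − N(G¹;H¹;1)` (Harris);
* `k = 1`: `c(f,G⁰,H⁰) + [N(G¹H¹;1;f̄) − N(G¹;H¹;f̄)] + [N(fG⁰H¹;1;1) − N(fG⁰;H¹;1)] + [N(fH⁰G¹;1;1) − N(fH⁰;G¹;1)]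
           + N(fδη;1;1) + N(f̄G¹η;1;1) + N(f̄δH⁰;1;1) + N(f̄;δ;η)`;
* `k = 2`: `[N(G¹H¹;1;1) − N(G¹;H¹;1)] + [N(G¹H¹;1;f̄) − N(G¹;H¹;f̄)] + [N(fG⁰H¹;1;1) − N(fG⁰;H¹;1)] + [N(fH⁰G¹;1;1) − N(fH⁰;G¹;1)]
           + N(δη;1;1) + N(f̄δH⁰;1;1) + N(f̄G⁰η;1;1)`.
So the universal-goodness hypothesis enters ONLY through `c(f, G⁰, H⁰) ≥ 0` (the bottom sections), the slice `k = 2` is Harris-only, and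
★★ `UGood.orAdj_free`: **if `(f, G⁰)` is universally good then so is `(f ∨ x₀, G)`**.  Together with `UGood.andAdj_free` (`…PairHalfAnd`):
**a top-level literal of either member of a pair can always be peeled off** — `(x₀ ∧ f, G)` reduces to `(f, G¹)` and `(x₀ ∨ f, G)` to
`(f, G⁰)`, one dimension down, whatever the other member does with `x₀`.  §3: every word of top-level AND/OR literals adjoined to a
function on `≤ 4` coordinates, against ARBITRARY `G` (`uGood_litAdjoin_of_le_four`, no `skip` letters): Kahn's inequality for
`A = ℓ₁ ⋄₁ (ℓ₂ ⋄₂ (⋯ (ℓ_m ⋄_m A')))` (`⋄_i ∈ {∧, ∨}`, literals `ℓ_i = x_i`, `A'` on four other variables) with `B` and `C` ARBITRARY.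
Nothing conjectural is used.  [this work]
-/

namespace Summit.CriticalPhenomena.PercolationContinuityZ3.Theorems.SahiThreeCopy

open Finset Function Literature.Combinatorics.Sahi2008
open scoped BigOperators

noncomputable section

variable {d : ℕ}

/-! ### §1 The half-literal OR step at every profile -/

/-- ★★ `c_b(f ∨ x₀, G, H) ≥ 0` for ARBITRARY nonnegative monotone `G, H` on `{0,1}^{d+1}`, given only `c_{b'}(f, G⁰, H⁰) ≥ 0` on the old
coordinates (and `0 ≤ f ≤ 1` monotone).  Exact slice identities in the module docstring. [this work] -/
theorem tc_orAdj_free_nonneg (b : Fin (d + 1) → ℕ) {f : Pt d → ℝ} (hf : ∀ x, 0 ≤ f x) (hf1 : ∀ x, f x ≤ 1) (hfm : Monotone f)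
    {G : Pt (d + 1) → ℝ} (hG : ∀ w, 0 ≤ G w) (hGm : Monotone G) {H : Pt (d + 1) → ℝ} (hH : ∀ w, 0 ≤ H w) (hHm : Monotone H)
    (hfg : 0 ≤ tc (Fin.tail b) f (sec G false) (sec H false)) : 0 ≤ tc b (orAdj true f) G H := by
  have hb : b = Fin.cons (b 0) (Fin.tail b) := (Fin.cons_self_tail b).symm
  set b' := Fin.tail b
  have hG0n : ∀ x, 0 ≤ (sec G false) x := sec_nonneg hG false
  have hG1n : ∀ x, 0 ≤ (sec G true) x := sec_nonneg hG true
  have hG1m : Monotone (sec G true) := sec_monotone hGm true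
  have hG0m : Monotone (sec G false) := sec_monotone hGm false
  have hG01 : ∀ x, (sec G false) x ≤ (sec G true) x := sec_false_le_sec_true hGm
  have hδ : ∀ x, 0 ≤ ((sec G true) - (sec G false)) x := fun x => sub_nonneg.2 (hG01 x)
  have hH0n : ∀ x, 0 ≤ (sec H false) x := sec_nonneg hH false
  have hH1n : ∀ x, 0 ≤ (sec H true) x := sec_nonneg hH true
  have hH1m : Monotone (sec H true) := sec_monotone hHm true
  have hH0m : Monotone (sec H false) := sec_monotone hHm false
  have hH01 : ∀ x, (sec H false) x ≤ (sec H true) x := sec_false_le_sec_true hHm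
  have hη : ∀ x, 0 ≤ ((sec H true) - (sec H false)) x := fun x => sub_nonneg.2 (hH01 x)
  have hfb : ∀ x, 0 ≤ ((1 : Pt d → ℝ) - f) x := fun x => sub_nonneg.2 (hf1 x)
  have hfG0n : ∀ x, 0 ≤ (f * sec G false) x := fun x => mul_nonneg (hf x) (hG0n x)
  have hfG0m : Monotone (f * sec G false) := hfm.mul hG0m hf hG0n
  have hfH0n : ∀ x, 0 ≤ (f * sec H false) x := fun x => mul_nonneg (hf x) (hH0n x)
  have hfH0m : Monotone (f * sec H false) := hfm.mul hH0m hf hH0n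
  have one_nn : ∀ x : Pt d, (0 : ℝ) ≤ (1 : Pt d → ℝ) x := fun _ => zero_le_one
  -- Harris gaps (the second one with the antitone spectator `1 - f ≥ 0`)
  have A0 : N3 b' (sec G true) (sec H true) 1 ≤ N3 b' (sec G true * sec H true) 1 1 :=
    N3_le_N3_mul d b' (sec G true) (sec H true) 1 hG1n hG1m hH1n hH1m one_nn
  have A1 : N3 b' (sec G true) (sec H true) (1 - f) ≤ N3 b' (sec G true * sec H true) 1 (1 - f) :=
    N3_le_N3_mul d b' (sec G true) (sec H true) (1 - f) hG1n hG1m hH1n hH1m hfb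
  have A2 : N3 b' (f * sec G false) (sec H true) 1 ≤ N3 b' (f * sec G false * sec H true) 1 1 :=
    N3_le_N3_mul d b' (f * sec G false) (sec H true) 1 hfG0n hfG0m hH1n hH1m one_nn
  have A3 : N3 b' (f * sec H false) (sec G true) 1 ≤ N3 b' (f * sec H false * sec G true) 1 1 :=
    N3_le_N3_mul d b' (f * sec H false) (sec G true) 1 hfH0n hfH0m hG1n hG1m one_nn
  -- nonnegative pieces
  have P1 : 0 ≤ N3 b' (f * (sec G true - sec G false) * (sec H true - sec H false)) 1 1 :=
    N3_nonneg b' (fun x => mul_nonneg (mul_nonneg (hf x) (hδ x)) (hη x)) one_nn one_nn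
  have P2 : 0 ≤ N3 b' ((1 - f) * sec G true * (sec H true - sec H false)) 1 1 :=
    N3_nonneg b' (fun x => mul_nonneg (mul_nonneg (hfb x) (hG1n x)) (hη x)) one_nn one_nn
  have P3 : 0 ≤ N3 b' ((1 - f) * (sec G true - sec G false) * sec H false) 1 1 :=
    N3_nonneg b' (fun x => mul_nonneg (mul_nonneg (hfb x) (hδ x)) (hH0n x)) one_nn one_nn
  have P4 : 0 ≤ N3 b' (1 - f) (sec G true - sec G false) (sec H true - sec H false) := N3_nonneg b' hfb hδ hη
  have P5 : 0 ≤ N3 b' ((sec G true - sec G false) * (sec H true - sec H false)) 1 1 :=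
    N3_nonneg b' (fun x => mul_nonneg (hδ x) (hη x)) one_nn one_nn
  have P6 : 0 ≤ N3 b' ((1 - f) * sec G false * (sec H true - sec H false)) 1 1 :=
    N3_nonneg b' (fun x => mul_nonneg (mul_nonneg (hfb x) (hG0n x)) (hη x)) one_nn one_nn
  -- bridges
  have e1 : N3 b' (sec H false) (sec G true) 1 = N3 b' (sec G true) (sec H false) 1 := N3_comm12 b' _ _ 1
  have e2 : N3 b' (sec H false) (sec G false) 1 = N3 b' (sec G false) (sec H false) 1 := N3_comm12 b' _ _ 1
  have e3 : N3 b' (sec G true) (sec H true) f = N3 b' f (sec G true) (sec H true) := by rw [N3_comm13, N3_comm23]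
  have e4 : N3 b' (sec G true * sec H true) 1 f = N3 b' f (sec G true * sec H true) 1 := by rw [N3_comm13, N3_comm23]
  have e5 : N3 b' (f * sec G false) (sec H true) 1 = N3 b' (sec H true) (f * sec G false) 1 := N3_comm12 b' _ _ 1
  have e6 : N3 b' (f * sec H false) (sec G true) 1 = N3 b' (sec G true) (f * sec H false) 1 := N3_comm12 b' _ _ 1
  have e7 : N3 b' (f * sec H false * sec G true) 1 1 = N3 b' (f * sec G true * sec H false) 1 1 := by rw [mul_right_comm]
  have e8 : N3 b' 1 (sec G true) (sec H true) = N3 b' (sec G true) (sec H true) 1 := by rw [N3_comm12, N3_comm23]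
  have e9 : N3 b' 1 (sec G true) (sec H false) = N3 b' (sec G true) (sec H false) 1 := by rw [N3_comm12, N3_comm23]
  have e10 : N3 b' 1 (sec G false) (sec H true) = N3 b' (sec G false) (sec H true) 1 := by rw [N3_comm12, N3_comm23]
  have e11 : N3 b' 1 (sec G false) (sec H false) = N3 b' (sec G false) (sec H false) 1 := by rw [N3_comm12, N3_comm23]
  have e12 : N3 b' 1 (sec G true * sec H true) 1 = N3 b' (sec G true * sec H true) 1 1 := N3_comm12 b' _ _ 1
  have e13 : N3 b' 1 (sec G true * sec H false) 1 = N3 b' (sec G true * sec H false) 1 1 := N3_comm12 b' _ _ 1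
  have e14 : N3 b' 1 (sec G false * sec H true) 1 = N3 b' (sec G false * sec H true) 1 1 := N3_comm12 b' _ _ 1
  have e15 : N3 b' 1 (sec G false * sec H false) 1 = N3 b' (sec G false * sec H false) 1 1 := N3_comm12 b' _ _ 1
  have e16 : N3 b' (sec H true) (sec G true) 1 = N3 b' (sec G true) (sec H true) 1 := N3_comm12 b' _ _ 1
  have e17 : N3 b' (sec H true) (sec G false) 1 = N3 b' (sec G false) (sec H true) 1 := N3_comm12 b' _ _ 1
  have e18 : N3 b' (sec G false) 1 (sec H false) = N3 b' (sec G false) (sec H false) 1 := N3_comm23 b' _ 1 _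
  have e19 : N3 b' (sec G false) 1 (sec H true) = N3 b' (sec G false) (sec H true) 1 := N3_comm23 b' _ 1 _
  have e20 : N3 b' (sec G true) 1 (sec H false) = N3 b' (sec G true) (sec H false) 1 := N3_comm23 b' _ 1 _
  have e21 : N3 b' (sec G true) 1 (sec H true) = N3 b' (sec G true) (sec H true) 1 := N3_comm23 b' _ 1 _
  simp only [mul_sub, sub_mul, one_mul, N3_sub_left, N3_sub_mid, N3_sub_right] at A1 P1 P2 P3 P4 P5 P6
  rw [hb]
  match hk : b 0 with
  | 0 =>
    rw [tc_cons_zero, sec_orAdj_true_false]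
    exact hfg
  | 1 =>
    rw [tc_cons_one]
    simp only [sec_orAdj_true_true, sec_orAdj_true_false]
    rw [tc_comm12 b' 1 (sec G false) (sec H false), tc_comm23 b' (sec G false) 1 (sec H false), tc_one_right]
    unfold tc at hfg ⊢
    simp only [mul_sub, sub_mul, one_mul, N3_sub_left, N3_sub_mid]
    linarith [hfg, A1, A2, A3, P1, P2, P3, P4, e1, e2, e3, e4, e5, e6, e7, e8, e9, e10, e11, e12, e13, e14, e15, e16, e17, e18, e19,
      e20, e21]
  | 2 =>
    rw [tc_cons_two]
    simp only [sec_orAdj_true_true, sec_orAdj_true_false]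
    rw [tc_comm12 b' 1 (sec G false) (sec H true), tc_comm23 b' (sec G false) 1 (sec H true), tc_one_right,
      tc_comm12 b' 1 (sec G true) (sec H false), tc_comm23 b' (sec G true) 1 (sec H false), tc_one_right]
    unfold tc
    simp only [mul_sub, sub_mul, one_mul, N3_sub_left, N3_sub_mid]
    linarith [A0, A1, A2, A3, P3, P5, P6, e1, e2, e3, e4, e5, e6, e7, e8, e9, e10, e11, e12, e13, e14, e15, e16, e17, e18, e19,
      e20, e21]
  | 3 =>
    rw [tc_cons_three, sec_orAdj_true_true, tc_comm12, tc_comm23]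
    exact tc_one_right_nonneg b' hG1n hG1m hH1n hH1m
  | k + 4 =>
    rw [tc_cons_add_four]

/-! ### §2 Universally good pairs: peeling a top-level literal of one member -/

/-- ★★ **The half-literal OR step**: if `(f, G⁰)` is universally good (`f ≤ 1`) and `G` is nonnegative monotone, then `(f ∨ x₀, G)` is
universally good — `x₀` enters the second member ARBITRARILY. [this work] -/
theorem UGood.orAdj_free {f : Pt d → ℝ} {G : Pt (d + 1) → ℝ} (h : UGood f (sec G false)) (hf1 : ∀ x, f x ≤ 1) (hG : ∀ w, 0 ≤ G w)
    (hGm : Monotone G) : UGood (SahiThreeCopy.orAdj true f) G :=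
  ⟨orAdj_nonneg true h.1, hG, orAdj_monotone true hf1 h.2.2.1, hGm, fun b _ hH hHm =>
    tc_orAdj_free_nonneg b h.1 hf1 h.2.2.1 hG hGm hH hHm (h.2.2.2.2 _ _ (sec_nonneg hH false) (sec_monotone hHm false))⟩

/-- The same with the literal on the second member: `UG(F⁰, g) ⇒ UG(F, g ∨ x₀)`. [this work] -/
theorem UGood.orAdj_free_right {F : Pt (d + 1) → ℝ} {g : Pt d → ℝ} (h : UGood (sec F false) g) (hg1 : ∀ x, g x ≤ 1)
    (hF : ∀ w, 0 ≤ F w) (hFm : Monotone F) : UGood F (SahiThreeCopy.orAdj true g) :=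
  (h.symm.orAdj_free hg1 hF hFm).symm

/-- `litAdj andL = andAdj true` (the two spellings of `f ∧ x₀` in `…MixedLiterals` and `…Literals`). [this work] -/
theorem litAdj_andL_eq (f : Pt d → ℝ) : litAdj Kind.andL f = SahiThreeCopy.andAdj true f := by
  funext x; by_cases hx : x 0 = true <;> simp [litAdj, SahiThreeCopy.andAdj, hx]

/-- `litAdj orL = orAdj true` (the two spellings of `f ∨ x₀`). [this work] -/
theorem litAdj_orL_eq (f : Pt d → ℝ) : litAdj Kind.orL f = SahiThreeCopy.orAdj true f := by
  funext x; by_cases hx : x 0 = true <;> simp [litAdj, SahiThreeCopy.orAdj, hx]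

/-! ### §3 Iteration from the settled base: words of top-level literals against ARBITRARY `G` -/

/-- ★★ For `0 ≤ f ≤ 1` monotone on `d ≤ 4` coordinates, every word `κ : Fin m → {andL, orL}` of top-level literals in `m` fresh variables,
and EVERY nonnegative monotone `G` on all `d + m` coordinates, the pair `(litAdjoin m κ f, G)` is universally good — Kahn's inequality
(coefficientwise) for `A = x₁ ⋄₁ (x₂ ⋄₂ (⋯ (x_m ⋄_m A')))`, `⋄_i ∈ {∧, ∨}`, `A'` on four further variables, with `B` AND `C` ARBITRARY
increasing events. [this work] -/
theorem uGood_litAdjoin_of_le_four (hd : d ≤ 4) {f : Pt d → ℝ} (hf : ∀ x, 0 ≤ f x) (hf1 : ∀ x, f x ≤ 1) (hfm : Monotone f) :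
    ∀ (m : ℕ) (κ : Fin m → Kind), (∀ i, κ i ≠ Kind.skip) → ∀ {G : Pt (d + m) → ℝ}, (∀ w, 0 ≤ G w) → Monotone G →
      UGood (litAdjoin m κ f) G
  | 0, _, _, _, hG, hGm => uGood_of_le_four hd hf hfm hG hGm
  | m + 1, κ, hκ, G, hG, hGm => by
    have props := litAdjoin_props m (Fin.tail κ) hf hf1 hfm
    have ih : ∀ {G' : Pt (d + m) → ℝ}, (∀ w, 0 ≤ G' w) → Monotone G' → UGood (litAdjoin m (Fin.tail κ) f) G' :=
      fun hG' hG'm => uGood_litAdjoin_of_le_four hd hf hf1 hfm m (Fin.tail κ) (fun i => hκ i.succ) hG' hG'm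
    show UGood (litAdj (κ 0) (litAdjoin m (Fin.tail κ) f)) G
    cases hκ0 : κ 0 with
    | skip => exact absurd hκ0 (hκ 0)
    | andL => rw [litAdj_andL_eq]; exact (ih (sec_nonneg hG true) (sec_monotone hGm true)).andAdj_free hG hGm
    | orL => rw [litAdj_orL_eq]; exact (ih (sec_nonneg hG false) (sec_monotone hGm false)).orAdj_free props.2.1 hG hGm

/-- Law-level form: `E₃^{coin q}(litAdjoin m κ f, G, H) ≥ 0` under every product measure, `G, H` arbitrary nonnegative monotone. [this work] -/
theorem sahiE_three_coin_litAdjoin_nonneg (hd : d ≤ 4) {f : Pt d → ℝ} (hf : ∀ x, 0 ≤ f x) (hf1 : ∀ x, f x ≤ 1) (hfm : Monotone f)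
    (m : ℕ) (κ : Fin m → Kind) (hκ : ∀ i, κ i ≠ Kind.skip) {G H : Pt (d + m) → ℝ} (hG : ∀ w, 0 ≤ G w) (hGm : Monotone G)
    (hH : ∀ w, 0 ≤ H w) (hHm : Monotone H) {q : Fin (d + m) → ℝ} (hq : ∀ i, 0 ≤ q i ∧ q i ≤ 1) :
    0 ≤ sahiE (coinWeight q) 3 ![litAdjoin m κ f, G, H] :=
  sahiE_three_coin_nonneg_of_tc hq fun b => (uGood_litAdjoin_of_le_four hd hf hf1 hfm m κ hκ hG hGm).2.2.2.2 b H hH hHm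

end

end Summit.CriticalPhenomena.PercolationContinuityZ3.Theorems.SahiThreeCopy
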